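import Mathlib
import Summits.Ventures.PercRepro2.CoinTreeCore
import Summits.Ventures.PercRepro2.CoinTreeAncestor
import Summits.Ventures.PercRepro2.CoinOrTailKDefs
import Summits.Ventures.PercRepro2.CoinOrTailKSums
import Summits.Ventures.PercRepro2.CoinOrTailKAlg
import Summits.Ventures.PercRepro2.CoinOrTailKCore

/-!
# Three routes into the tail below two markers — an instantiation check (blind cell PercRepro2,
night-2 g10; NIGHT2-DARC.md §41)

A concrete coin system on `Fin 9` (s = 0, m₁ = 1, r₁ = 2, r₂ = 3, m₂ = 4, r₃ = 5, a = 6, w = 7,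
t = 8): `s → m₁ → r₁ → a`, `m₁ → r₂ → a`, `s → m₂ → r₃ → a` — THREE entries `r₁, r₂, r₃` of the
tail, two below `m₁` and one below `m₂` — and the head coins `a → t`, `w → t`; eleven coins, all
random.  The core `U = {m₁, r₁, r₂, m₂, r₃}` is an out-tree (`TreeCore`, by `decide`),
`OrTailK` holds by `decide`, and `darc_of_orTailTreeK` gives row 2′DARC at `a → w` for the
markers `m₁, m₂` and every probability vector.  No two-entry theorem applies (three routes).
-/

namespace Summit.Ventures.PercRepro2.Coin

namespace OrTailKExample

open Classical

/-- The eleven coins of the example. -/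
def arcsEx : Fin 11 → Finset (Fin 9 × Fin 9)
  | 0 => {(0, 1)}   -- s → m₁
  | 1 => {(1, 2)}   -- m₁ → r₁
  | 2 => {(1, 3)}   -- m₁ → r₂
  | 3 => {(0, 4)}   -- s → m₂
  | 4 => {(4, 5)}   -- m₂ → r₃
  | 5 => {(2, 6)}   -- r₁ → a
  | 6 => {(3, 6)}   -- r₂ → a
  | 7 => {(5, 6)}   -- r₃ → a
  | 8 => {(6, 8)}   -- a → t
  | 9 => {(7, 8)}   -- w → t
  | 10 => {(1, 7)}  -- m₁ → w

/-- The entry coins: `c r₁ = 5`, `c r₂ = 6`, `c r₃ = 7`. -/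
def cEx : Fin 9 → Fin 11
  | 2 => 5
  | 3 => 6
  | 5 => 7
  | _ => 0

/-- The tree coins. -/
def tcEx : Fin 9 → Fin 11
  | 1 => 0
  | 2 => 1
  | 3 => 2
  | 4 => 3
  | 5 => 4
  | _ => 0

/-- The parent map. -/
def parEx : Fin 9 → Fin 9
  | 1 => 0
  | 2 => 1
  | 3 => 1
  | 4 => 0
  | 5 => 4
  | _ => 0

/-- The rank. -/
def rkEx : Fin 9 → ℕ
  | 1 => 1
  | 2 => 2
  | 3 => 2
  | 4 => 1
  | 5 => 2
  | _ => 0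

/-- Every coin is a single arc, so `SameEnds` holds. -/
lemma sameEnds_ex : SameEnds arcsEx := by
  intro e xy hxy x'y' hx'y'
  fin_cases e <;> simp [arcsEx] at hxy hx'y' <;> subst hxy <;> subst hx'y' <;>
    exact ⟨Or.inl rfl, Or.inr rfl⟩

/-- `{m₁, r₁, r₂, m₂, r₃}` is an out-tree core of `s`. -/
lemma treeCore_ex : TreeCore arcsEx 0 {1, 2, 3, 4, 5} tcEx parEx rkEx where
  tree := by decide
  par_mem := by decide
  rank := by decide
  into_C := by decide
  into_s := by decide
  s_notin := by decide

/-- The core with the tail `a = 6` entered from `r₁, r₂, r₃` is a three-entry OR-tail. -/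
lemma orTailK_ex : OrTailK arcsEx 0 {1, 2, 3, 4, 5} {2, 3, 5} cEx 6 where
  ent_sub := by decide
  s_notin := by decide
  a_notin := by decide
  a_ne_s := by decide
  into_U := by decide
  into_s := by decide
  into_a := by decide
  arcs_c := by decide
  c_inj := by decide

/-- **Row 2′DARC at the arc `a → w` for the markers `m₁, m₂` with THREE routes into the tail,
for every probability vector** — no hypothesis beyond `IsProbVec`. -/
theorem darc_orTailK_example {R : Type*} [Field R] [LinearOrder R] [IsStrictOrderedRing R]
    (pr : Fin 11 → R) (hp : IsProbVec pr) :
    DARC pr arcsEx 0 {8} 1 4 6 7 :=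
  darc_of_orTailTreeK pr hp sameEnds_ex orTailK_ex treeCore_ex (by decide) (by decide)
    (by
      intro r hr
      fin_cases hr
      · exact Or.inl ⟨1, by decide, by decide⟩
      · exact Or.inl ⟨1, by decide, by decide⟩
      · exact Or.inr ⟨1, by decide, by decide⟩)
    (by decide) (by decide) (by decide) (by decide)

end OrTailKExample

end Summit.Ventures.PercRepro2.Coin
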